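import Summits.QuantumFields.GaugeBoot.BootstrapCertificateCompleteness
import Summits.QuantumFields.GaugeBoot.BootstrapStrongCoupling
import HarnessLib

/-!
# `SU(N)` on `ℤ^d`: SOS ⊕ loop-equation certificates bound every infinite-volume Gibbs state, and are complete (gauge-boot, L1/L4 supplement)

HONEST FRAMING (cell `pub-gaugeboot`, page 1 of every file): the venture produces certified bounds
on lattice expectations at stated coupling, gauge group, dimension and torus size; NOT a mass gap,
NOT a continuum limit, NOT a string tension; NOT Yang–Mills-summit-bearing (barriers
`FixedCouplingUltralocality`, `PerturbativeInvisibility`). Structural; it certifies no number.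

## Content (the infinite-volume setting of Anderson–Kruczenski / Kazakov–Zheng: `SU(N)` on `ℤ^d`, every `d`, `N`, every real `β`)

The word-truncated bootstrap on `ℤ^d` (`IsBootstrapFeasible` with the one-link boundary actions
`S_e = wilsonBoundaryAction ρ {e}` and test functions of word length `≤ n`) has the certificate cone
`certConeZdSuN N β n` (SOS of level-`n` test functions + level-`n` Schwinger–Dyson rows).

* ★★ SOUNDNESS FOR ALL GIBBS STATES `dlr_integral_le_of_mem_certCone_suN` (+ lower twin): a
  level-`n` certificate `c • 1 - P = σ + ρ` proves `∫ P dμ ≤ c` for EVERY infinite-volume DLR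
  state `μ ∈ 𝒢(β)` of the Wilson action — all boundary conditions, all phases
  (every DLR state is feasible at every level, `isBootstrapFeasible_dlr_suN`).
* ★★★ NO DUALITY GAP `forall_zdFeasible_apply_le_iff_suN`, `exists_zd_certificate_suN`: for `P`
  in the level-`n` certificate domain, `φ P ≤ c` for every level-`n` feasible `φ` iff
  `(c + ε) • 1 - P ∈ certConeZdSuN N β n` for all `ε > 0` (a feasible functional exists: DLR
  states exist by compactness, `ymGibbsMeasures_nonempty`).
* ★★★ COMPLETENESS FOR THE GIBBS STATES `exists_certificate_of_forall_dlr_le_suN`: if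
  `∫ P dμ ≤ c₀` for EVERY DLR state `μ` and `c₀ < c`, then SOME level certifies `c • 1 - P`
  (completeness at a level + `bootstrap_convergence_dlr_suN`); at strong coupling
  `6(d-1)N|β| < 1` (unique DLR state `ν`) every `c > ∫ P dν` is certified
  (`exists_certificate_of_dlr_lt_suN_of_small`).

So the infinite-volume lattice bootstrap proves exactly the polynomial expectation bounds valid in
all Gibbs states: nothing weaker (soundness) and, up to the strictness of the inequality and the
unspecified level, nothing less (completeness).

References: Anderson–Kruczenski, Nucl. Phys. B 921 (2017); Kazakov–Zheng, arXiv:2203.11360,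
arXiv:2404.16925; Josz–Henrion, Optim. Lett. 10 (2016) 3; Georgii, Gibbs Measures (2011) Ch. 4
(existence of DLR states by compactness). Folklore.
-/

noncomputable section

open MeasureTheory Filter Topology NormedSpace
open Literature.MathematicalPhysics.QuantumFieldTheory (LatticeRep ymGibbsMeasures_nonempty)
open Literature.MathematicalPhysics.QuantumLattice

namespace Summit.QuantumFields.GaugeBoot

open OrderUnitDuality

section ZdSuN

variable {d : ℕ} (N : ℕ) (β : ℝ)

/-- **The level-`n` certificate cone of the `SU(N)` bootstrap on `ℤ^d`.** [folklore] -/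
abbrev certConeZdSuN (n : ℕ) :
    PointedCone ℝ C(LGConfig d (Matrix.specialUnitaryGroup (Fin N) ℂ), ℝ) :=
  certCone (fundamentalLatticeRep N) (suExp N)
    (fun e => wilsonBoundaryAction (fundamentalRep (Fin N)) {e}) β
    (wordTruncation (ι := ZdEdge d) (fundamentalLatticeRep N) n)

/-- **The level-`n` certificate domain of the `SU(N)` bootstrap on `ℤ^d`.** [folklore] -/
abbrev certDomainZdSuN (n : ℕ) :
    Submodule ℝ C(LGConfig d (Matrix.specialUnitaryGroup (Fin N) ℂ), ℝ) :=
  certDomain (fundamentalLatticeRep N) (suExp N)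
    (fun e => wilsonBoundaryAction (fundamentalRep (Fin N)) {e}) β n

/-- The one-link boundary actions have polynomial derivatives along the `𝔰𝔲(N)` shifts. -/
theorem wilsonBoundaryAction_polyDeriv_suN (i : ZdEdge d) (a : SuGenerator N) :
    ∃ S' ∈ polyAlgebra (ι := ZdEdge d) (fundamentalLatticeRep N),
      ∀ U : LGConfig d (Matrix.specialUnitaryGroup (Fin N) ℂ),
        HasDerivAt (fun t => wilsonBoundaryAction (fundamentalRep (Fin N)) {i}
          (Function.update U i (suExp N a t * U i))) (S' U) 0 :=
  exists_polyDeriv_of_mem_polyFunctions (fundamentalLatticeRep N)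
    (S := fun e => wilsonBoundaryAction (fundamentalRep (Fin N)) {e}) (suExp_add N)
    (X := fun X : SuGenerator N => (X : Matrix (Fin N) (Fin N) ℂ)) (rho_suExp N)
    (fun e => wilsonBoundaryAction_mem_polyFunctions (fundamentalLatticeRep N) {e}) i a

/-- **The level-`n` feasible set on `ℤ^d` is non-empty**: DLR states exist at every `β` and are
feasible. -/
theorem exists_zdFeasible_suN (n : ℕ) :
    ∃ φ₀ : C(LGConfig d (Matrix.specialUnitaryGroup (Fin N) ℂ), ℝ) →ₗ[ℝ] ℝ,
      IsBootstrapFeasible (fundamentalLatticeRep N) (suExp N)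
        (fun e => wilsonBoundaryAction (fundamentalRep (Fin N)) {e}) β
        (wordTruncation (ι := ZdEdge d) (fundamentalLatticeRep N) n) φ₀ := by
  obtain ⟨μ, hμ⟩ := ymGibbsMeasures_nonempty (d := d) (fundamentalRep (Fin N))
    (continuous_fundamentalRep _) β
  exact ⟨_, isBootstrapFeasible_dlr_suN N β hμ (wordTruncation_subset_polyAlgebra _ n)⟩

/-! ### Soundness: certificates bound every Gibbs state -/

/-- ★★ **A level-`n` certificate bounds the expectation of `P` in EVERY infinite-volume Gibbs
state** of `SU(N)` lattice Yang–Mills at `β` (all boundary conditions, all phases). [folklore] -/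
theorem dlr_integral_le_of_mem_certCone_suN {n : ℕ}
    {P : C(LGConfig d (Matrix.specialUnitaryGroup (Fin N) ℂ), ℝ)} {c : ℝ}
    (hc : c • (1 : C(LGConfig d (Matrix.specialUnitaryGroup (Fin N) ℂ), ℝ)) - P ∈
      certConeZdSuN (d := d) N β n)
    {μ : Measure (LGConfig d (Matrix.specialUnitaryGroup (Fin N) ℂ))}
    (hμ : μ ∈ ymGibbsMeasures (d := d) (fundamentalRep (Fin N)) β) :
    ∫ U, P U ∂μ ≤ c := by
  haveI := hμ.1
  have h := (isBootstrapFeasible_dlr_suN N β hμ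
    (wordTruncation_subset_polyAlgebra _ n)).apply_le_of_mem_certCone _ hc
  rwa [expectationFunctional_apply] at h

/-- ★★ **Lower-bound certificates bound every Gibbs state from below.** [folklore] -/
theorem le_dlr_integral_of_mem_certCone_suN {n : ℕ}
    {P : C(LGConfig d (Matrix.specialUnitaryGroup (Fin N) ℂ), ℝ)} {c : ℝ}
    (hc : P - c • (1 : C(LGConfig d (Matrix.specialUnitaryGroup (Fin N) ℂ), ℝ)) ∈
      certConeZdSuN (d := d) N β n)
    {μ : Measure (LGConfig d (Matrix.specialUnitaryGroup (Fin N) ℂ))}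
    (hμ : μ ∈ ymGibbsMeasures (d := d) (fundamentalRep (Fin N)) β) :
    c ≤ ∫ U, P U ∂μ := by
  haveI := hμ.1
  have h := (isBootstrapFeasible_dlr_suN N β hμ
    (wordTruncation_subset_polyAlgebra _ n)).le_apply_of_mem_certCone _ hc
  rwa [expectationFunctional_apply] at h

/-! ### Completeness at a fixed level -/

/-- ★★★ **No duality gap for the `SU(N)` bootstrap on `ℤ^d`.** For `P` in the level-`n`
certificate domain: `φ P ≤ c` for every level-`n` feasible `φ` iff `(c + ε) • 1 - P` has a
level-`n` certificate for every `ε > 0`. [folklore] -/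
theorem forall_zdFeasible_apply_le_iff_suN {n : ℕ}
    {P : C(LGConfig d (Matrix.specialUnitaryGroup (Fin N) ℂ), ℝ)}
    (hP : P ∈ certDomainZdSuN (d := d) N β n) {c : ℝ} :
    (∀ φ : C(LGConfig d (Matrix.specialUnitaryGroup (Fin N) ℂ), ℝ) →ₗ[ℝ] ℝ,
      IsBootstrapFeasible (fundamentalLatticeRep N) (suExp N)
        (fun e => wilsonBoundaryAction (fundamentalRep (Fin N)) {e}) β
        (wordTruncation (ι := ZdEdge d) (fundamentalLatticeRep N) n) φ → φ P ≤ c) ↔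
      ∀ ε : ℝ, 0 < ε → (c + ε) • (1 : C(LGConfig d (Matrix.specialUnitaryGroup (Fin N) ℂ), ℝ))
        - P ∈ certConeZdSuN (d := d) N β n :=
  forall_feasible_apply_le_iff (fundamentalLatticeRep N) (wilsonBoundaryAction_polyDeriv_suN N)
    (exists_zdFeasible_suN N β n) hP

/-- ★★★ **Every constant strictly above the level-`n` `ℤ^d` SDP maximum has a level-`n`
certificate** `c' • 1 - P = σ + ρ`. [folklore] -/
theorem exists_zd_certificate_suN {n : ℕ}
    {P : C(LGConfig d (Matrix.specialUnitaryGroup (Fin N) ℂ), ℝ)}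
    (hP : P ∈ certDomainZdSuN (d := d) N β n) {c c' : ℝ}
    (h : ∀ φ : C(LGConfig d (Matrix.specialUnitaryGroup (Fin N) ℂ), ℝ) →ₗ[ℝ] ℝ,
      IsBootstrapFeasible (fundamentalLatticeRep N) (suExp N)
        (fun e => wilsonBoundaryAction (fundamentalRep (Fin N)) {e}) β
        (wordTruncation (ι := ZdEdge d) (fundamentalLatticeRep N) n) φ → φ P ≤ c) (hc : c < c') :
    ∃ σ ∈ sosCone (wordTruncation (ι := ZdEdge d) (fundamentalLatticeRep N) n),
      ∃ ρ ∈ rowSpace (fundamentalLatticeRep N) (suExp N)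
        (fun e => wilsonBoundaryAction (fundamentalRep (Fin N)) {e}) β
        (wordTruncation (ι := ZdEdge d) (fundamentalLatticeRep N) n),
        σ + ρ = c' • (1 : C(LGConfig d (Matrix.specialUnitaryGroup (Fin N) ℂ), ℝ)) - P :=
  exists_certificate_of_forall_apply_le (fundamentalLatticeRep N)
    (wilsonBoundaryAction_polyDeriv_suN N) (exists_zdFeasible_suN N β n) hP h hc

/-- ★★ **The `ℤ^d` SDP maximum is attained and equals the infimum of the certified bounds.**
[folklore] -/
theorem sSup_zdFeasibleValues_eq_sInf_suN {n : ℕ}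
    {P : C(LGConfig d (Matrix.specialUnitaryGroup (Fin N) ℂ), ℝ)}
    (hP : P ∈ certDomainZdSuN (d := d) N β n) :
    sSup (feasibleValues (fundamentalLatticeRep N) (suExp N)
        (fun e => wilsonBoundaryAction (fundamentalRep (Fin N)) {e}) β n P) =
      sInf {c : ℝ | c • (1 : C(LGConfig d (Matrix.specialUnitaryGroup (Fin N) ℂ), ℝ)) - P ∈
        certConeZdSuN (d := d) N β n} :=
  sSup_feasibleValues_eq_sInf (fundamentalLatticeRep N) (wilsonBoundaryAction_polyDeriv_suN N)
    (exists_zdFeasible_suN N β n) hP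

/-! ### Completeness for the Gibbs states -/

/-- ★★★ **Every polynomial bound strictly valid in all Gibbs states is certified at some level.**
`SU(N)` on `ℤ^d`, any real `β`: if `∫ P dμ ≤ c₀` for every DLR state `μ ∈ 𝒢(β)` and `c₀ < c`,
then there are a level `n` and an SOS ⊕ loop-equation certificate `c • 1 - P = σ + ρ`.
[folklore] -/
theorem exists_certificate_of_forall_dlr_le_suN
    {P : C(LGConfig d (Matrix.specialUnitaryGroup (Fin N) ℂ), ℝ)}
    (hP : P ∈ polyAlgebra (ι := ZdEdge d) (fundamentalLatticeRep N)) {c₀ c : ℝ}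
    (h : ∀ μ ∈ ymGibbsMeasures (d := d) (fundamentalRep (Fin N)) β, ∫ U, P U ∂μ ≤ c₀)
    (hc : c₀ < c) :
    ∃ n : ℕ, ∃ σ ∈ sosCone (wordTruncation (ι := ZdEdge d) (fundamentalLatticeRep N) n),
      ∃ ρ ∈ rowSpace (fundamentalLatticeRep N) (suExp N)
        (fun e => wilsonBoundaryAction (fundamentalRep (Fin N)) {e}) β
        (wordTruncation (ι := ZdEdge d) (fundamentalLatticeRep N) n),
        σ + ρ = c • (1 : C(LGConfig d (Matrix.specialUnitaryGroup (Fin N) ℂ), ℝ)) - P := by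
  have hε : 0 < (c - c₀) / 2 := by linarith
  obtain ⟨n₁, hn₁⟩ := bootstrap_convergence_dlr_suN (d := d) N β
    (fun n => wordTruncation (ι := ZdEdge d) (fundamentalLatticeRep N) n)
    (fun a ha => eventually_mem_wordTruncation _ ha) hP hε
  obtain ⟨n₂, hn₂⟩ := (eventually_mem_wordTruncation (fundamentalLatticeRep N) hP).exists_forall_of_atTop
  refine ⟨max n₁ n₂, exists_zd_certificate_suN N β (mem_certDomain_of_mem_wordTruncation _
    (wordTruncation_mono _ ((le_max_right n₁ n₂).trans (Nat.le_add_right _ _)) (hn₂ n₂ le_rfl)))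
    (c := c₀ + (c - c₀) / 2) (fun φ hφ => ?_) (by linarith)⟩
  obtain ⟨μ, hμ, hclose⟩ := hn₁ φ (hφ.mono _ (wordTruncation_mono _ (le_max_left n₁ n₂)))
  have h1 := (abs_le.1 hclose).2
  linarith [h μ hμ]

/-- ★★★ **Strong coupling** (`6(d-1)N|β| < 1`, the DLR state `ν` is unique): every
`c > ∫ P dν` — every strict upper bound on THE infinite-volume expectation of a polynomial
observable — has an SOS ⊕ loop-equation certificate at some level. [folklore] -/
theorem exists_certificate_of_dlr_lt_suN_of_small {β : ℝ}
    (hβ : 6 * ((d - 1 : ℕ) : ℝ) * N * |β| < 1)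
    {ν : Measure (LGConfig d (Matrix.specialUnitaryGroup (Fin N) ℂ))}
    (hν : ν ∈ ymGibbsMeasures (d := d) (fundamentalRep (Fin N)) β)
    {P : C(LGConfig d (Matrix.specialUnitaryGroup (Fin N) ℂ), ℝ)}
    (hP : P ∈ polyAlgebra (ι := ZdEdge d) (fundamentalLatticeRep N)) {c : ℝ}
    (hc : ∫ U, P U ∂ν < c) :
    ∃ n : ℕ, ∃ σ ∈ sosCone (wordTruncation (ι := ZdEdge d) (fundamentalLatticeRep N) n),
      ∃ ρ ∈ rowSpace (fundamentalLatticeRep N) (suExp N)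
        (fun e => wilsonBoundaryAction (fundamentalRep (Fin N)) {e}) β
        (wordTruncation (ι := ZdEdge d) (fundamentalLatticeRep N) n),
        σ + ρ = c • (1 : C(LGConfig d (Matrix.specialUnitaryGroup (Fin N) ℂ), ℝ)) - P := by
  refine exists_certificate_of_forall_dlr_le_suN N β hP (c₀ := ∫ U, P U ∂ν) (fun μ hμ => ?_) hc
  rw [subsingleton_ymGibbsMeasures_allGroups (fundamentalRep (Fin N)) (continuous_fundamentalRep _)
    hβ hμ hν]

end ZdSuN

end Summit.QuantumFields.GaugeBoot

end
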